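import Summits.QuantumAdvantage.QuantumAdvantage.Theorems.SosSandwichTransferPBMachineDefs
import HarnessLib

/-!
# Crux `TransferPB` (stmt-QuantumAdvantage-15238, route SosSandwich), line `birth` — the machine's budget is an explicit natural number

For obligation (M) of `Theorems/SosSandwichTransferPBMachineSplit.lean`: the budget `machineBudget F x r c k`
(defined over `ℝ` with a ceiling, as the tree analysis wants it) is the explicit natural number
`16·T²·2^k·(400·d·(r(n)+1))^c·(r(n)+1) + 1` (`T` = number of oracle gates of `F.circ n`, `d = thm23Degree F x`),
so the transcript machine computes it by integer arithmetic.

* `machineBudget_real_eq` — the real expression under the ceiling is that natural number;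
* **`machineBudget_eq`** — `machineBudget F x r c k = 16 T² 2^k (400 d (r(n)+1))^c (r(n)+1) + 1`.

All proved; no named fact. [folklore]
-/

-- D-0017: single-conjunct summit ⇒ the duplicate `QuantumAdvantage.QuantumAdvantage` is mandated.
set_option linter.dupNamespace false

noncomputable section

namespace Summit.QuantumAdvantage.QuantumAdvantage.Cruxes.TransferPB.Birth

open Literature.Computability.Cryptography Literature.Computability.QuantumComplexity

namespace SimTreePB

variable (F : QCircuitFamily cliffordT) (x : List Bool) (r : Polynomial ℕ) (c k : ℕ)

/-- The real number under the ceiling of `machineBudget` is the natural number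
`16·T²·2^k·(400·d·(r(n)+1))^c·(r(n)+1)`. [folklore] -/
theorem machineBudget_real_eq :
    8 * ((F.circ x.length).oracleQueries : ℝ) ^ 2 /
        (pbThreshold F x r c k / 2 * (1 / (((r.eval x.length : ℕ) : ℝ) + 1))) =
      ((16 * (F.circ x.length).oracleQueries ^ 2 * 2 ^ k *
          (400 * thm23Degree F x * (r.eval x.length + 1)) ^ c * (r.eval x.length + 1) : ℕ) : ℝ) := by
  unfold pbThreshold
  set T : ℝ := ((F.circ x.length).oracleQueries : ℝ) with hT
  set R : ℝ := ((r.eval x.length : ℕ) : ℝ) + 1 with hR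
  set d : ℝ := (thm23Degree F x : ℝ) with hd
  have hRpos : 0 < R := by positivity
  have hdpos : 0 < d := by
    have : 1 ≤ thm23Degree F x := by unfold thm23Degree; omega
    rw [hd]; exact_mod_cast this
  have h2k : (0 : ℝ) < 2 ^ k := by positivity
  -- the threshold in closed form: `w = 2^{-k} (1/(400 d R))^c`
  have hw : (1 / 2 ^ k : ℝ) * ((((1 / 10 : ℝ) ^ 2 * (1 / R)) / 2) / 2 / d) ^ c =
      1 / (2 ^ k * (400 * d * R) ^ c) := by
    have h1 : (((1 / 10 : ℝ) ^ 2 * (1 / R)) / 2) / 2 / d = 1 / (400 * d * R) := by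
      field_simp
      ring
    rw [h1, one_div_pow, one_div_mul_one_div]
  rw [hw]
  push_cast
  rw [← hT, ← hd]
  have hR' : ((r.eval x.length : ℕ) : ℝ) + 1 = R := hR.symm
  rw [hR']
  field_simp
  ring

/-- **The budget as a natural number.** [folklore] -/
theorem machineBudget_eq :
    machineBudget F x r c k =
      16 * (F.circ x.length).oracleQueries ^ 2 * 2 ^ k *
          (400 * thm23Degree F x * (r.eval x.length + 1)) ^ c * (r.eval x.length + 1) + 1 := by
  unfold machineBudget
  rw [machineBudget_real_eq, Nat.ceil_natCast]

end SimTreePB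

end Summit.QuantumAdvantage.QuantumAdvantage.Cruxes.TransferPB.Birth

end
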